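import Literature.Topology.FourManifolds.DehnSurgeryFundamentalGroup
import Literature.Topology.FourManifolds.LongitudeSecondCommutator
import Literature.Topology.FourManifolds.KnotGroupAbelianization
import Literature.Topology.FourManifolds.KnotGroupMulEquivProofs
import Literature.AlgebraicTopology.FundamentalGroup.SphereSimplyConnected
import Mathlib.Analysis.SpecialFunctions.Complex.Circle
import HarnessLib

/-!
# Property R for knots with non-trivial Alexander polynomial: if `0`-surgery is `S² × S¹` then `Δ_K ≐ 1`

Topic `Literature/Topology/FourManifolds`; written for the fact seat of Property R
(`Literature.Topology.FourManifolds.isUnknot_of_isIntegralSurgery_zero`, Gabai 1987), assembling the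
classical **Alexander-module obstruction** from `DehnSurgeryFundamentalGroup.lean` (`π₁` of the
surgery is the knot group modulo the framed longitude) and `LongitudeSecondCommutator.lean` (the
`0`-framed longitude lies in `G''`).  **Everything in this file is proved; no definition of a
`Prop`, no named fact.**

* `Knot.commutator_le_commutator_commutator_of_isIntegralSurgery_zero` — if `0`-surgery on `K`
  yields a (Hausdorff) manifold `Y` with **abelian fundamental group**, then for some base point the
  knot group `G = π₁(S³ ∖ K, p₀)` satisfies **`G' = G''`**: `G' ≤ ker jA_* = ⟪λ⟫ ≤ ⁅G', G'⁆`.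
* `Knot.alexanderModule_subsingleton_of_isIntegralSurgery_zero` — hence its Alexander module
  `G'/G''` vanishes (at every base point for `Y = S² × S¹`:
  `Knot.alexanderModule_subsingleton_of_isIntegralSurgery_sphereTwo_prod_zero`).
* `fundamentalGroup_sphereTwo_prod_sphereOne_comm` — `π₁(S² × S¹)` is abelian
  (`π₁(S²) = 1`, `π₁(S¹) ≅ ℤ`, Hatcher Prop. 1.12 / 1.14 / Thm. 1.7).
* **`Knot.hasTrivialAlexanderPolynomial_of_isIntegralSurgery_sphereTwo_prod_zero`** — if
  `S² × S¹` is `0`-surgery on `K` then `Δ_K ≐ 1` (`K.HasTrivialAlexanderPolynomial`), and every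
  Alexander polynomial of `K` is a unit of `ℤ[t, t⁻¹]`
  (`Knot.isUnit_of_isAlexanderPolynomial_of_isIntegralSurgery_sphereTwo_prod_zero`).
* **`Knot.not_isIntegralSurgery_sphereTwo_prod_zero_of_not_isUnit`** — contrapositive: **Property R
  holds for every knot with an Alexander polynomial that is not a unit** (`Δ_K ≠ 1`).

This is the elementary half of Property R, the reason the conjecture (Kirby's problem list,
Problem 1.16) was open only for knots with `Δ_K = 1` until Gabai (1987): if `S³₀(K) ≅ S² × S¹`
then `π₁(S³₀(K)) ≅ ℤ`, so `G' = ⟪λ⟫ ⊆ G''` and the Alexander module `G'/G'' ≅ H₁` of the infinite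
cyclic cover vanishes.  The remaining case `Δ_K = 1` is exactly Gabai's theorem
(`isUnknot_of_isIntegralSurgery_zero`; Gabai, *Foliations and the topology of 3-manifolds III*,
J. Differential Geom. 26 (1987), Cor. 8.3), which is NOT proved here.

## References

* D. Gabai, *Foliations and the topology of 3-manifolds. III*, J. Differential Geom. 26 (1987)
  479–536, Cor. 8.3 and Remark 8.5 (Property R). [GabaiJDG1987]
* R. Kirby, *Problems in low dimensional manifold theory*, Proc. Sympos. Pure Math. 32 (1978),
  Problem 1.16 (Property R).
* D. Rolfsen, *Knots and Links* (1976), §7 (Alexander module as `H₁` of the infinite cyclic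
  cover), §9.F–G (surgery). [Rolfsen1976]
* A. Hatcher, *Algebraic Topology* (2002), Thm. 1.7, Prop. 1.12, Prop. 1.14. [HatcherAT2002]

## Design notes

* The hypothesis on the surgered manifold in the general statements is only that its fundamental
  groups are abelian (and Hausdorffness, for general position); `S² × S¹` is the instance.
* No definitions, no named facts, no `sorry`; the theorems depend only on `propext`,
  `Classical.choice`, `Quot.sound`.
-/

noncomputable section

open Set Function
open scoped Topology Manifold Real commutatorElement LaurentPolynomial
open _root_.Topology (IsOpenEmbedding)

namespace Literature.Topology.FourManifolds

/-! ### `G' = G''` when `0`-surgery has abelian fundamental group -/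

section Obstruction

variable {EY HY : Type*} [NormedAddCommGroup EY] [NormedSpace ℝ EY] [TopologicalSpace HY]
  {IY : ModelWithCorners ℝ EY HY} {Y : Type*} [TopologicalSpace Y] [ChartedSpace HY Y]

/-- A homomorphism into an abelian group kills the commutator subgroup. [folklore] -/
theorem commutator_le_ker_of_comm {G H : Type*} [Group G] [Group H] (f : G →* H)
    (hH : ∀ a b : H, a * b = b * a) : commutator G ≤ f.ker := by
  rw [commutator_def, Subgroup.commutator_le]
  rintro a - b -
  rw [MonoidHom.mem_ker, map_commutatorElement, commutatorElement_eq_one_iff_commute]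
  exact hH _ _

/-- **The Alexander-module obstruction, group form.** If the Hausdorff manifold `Y` is `0`-surgery
on the knot `K` and the fundamental groups of `Y` are abelian, then for the base point `p₀` of a
suitable (`0`-framed) tubular neighbourhood the knot group `G = π₁(S³ ∖ K, p₀)` satisfies
`G' ≤ ⁅G', G'⁆`, i.e. **`G' = G''`**: `G' ≤ ker jA_*` (`Y` has abelian `π₁`), `ker jA_* = ⟪λ⟫`
(`IsIntegralSurgery.exists_map_surjective_and_ker_eq`, van Kampen) and `λ ∈ G'' ⊴ G`
(`Knot.TubularNbhd.longitude_mem_commutator_commutator`). Rolfsen (1976), §7, §9.G. [folklore] -/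
theorem Knot.commutator_le_commutator_commutator_of_isIntegralSurgery_zero [T2Space Y] {K : Knot}
    (hY : ∀ (y : Y) (a b : FundamentalGroup Y y), a * b = b * a) (h : IsIntegralSurgery IY Y K 0) :
    ∃ ν : Knot.TubularNbhd K,
      commutator (FundamentalGroup K.complement ν.basePoint) ≤
        ⁅commutator (FundamentalGroup K.complement ν.basePoint),
          commutator (FundamentalGroup K.complement ν.basePoint)⁆ := by
  obtain ⟨ν, jA, hν0, -, -, hker⟩ := h.exists_map_surjective_and_ker_eq
  refine ⟨ν, ?_⟩
  have h1 : commutator (FundamentalGroup K.complement ν.basePoint) ≤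
      (FundamentalGroup.map jA ν.basePoint).ker :=
    commutator_le_ker_of_comm _ (hY _)
  rw [hker] at h1
  refine h1.trans (Subgroup.normalClosure_le_normal ?_)
  rintro _ rfl
  exact ν.longitude_mem_commutator_commutator hν0

/-- **The Alexander-module obstruction.** If the Hausdorff manifold `Y` is `0`-surgery on the knot
`K` and the fundamental groups of `Y` are abelian, then the Alexander module `G'/G''` of the knot
group `G = π₁(S³ ∖ K, p₀)` vanishes (at the base point of a suitable tubular neighbourhood).
Rolfsen (1976), §7.A–C (the Alexander module is `H₁` of the infinite cyclic cover), §9.G.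
[folklore] -/
theorem Knot.alexanderModule_subsingleton_of_isIntegralSurgery_zero [T2Space Y] {K : Knot}
    (hY : ∀ (y : Y) (a b : FundamentalGroup Y y), a * b = b * a) (h : IsIntegralSurgery IY Y K 0) :
    ∃ ν : Knot.TubularNbhd K,
      Subsingleton (alexanderModule (FundamentalGroup K.complement ν.basePoint)) := by
  obtain ⟨ν, hν⟩ := Knot.commutator_le_commutator_commutator_of_isIntegralSurgery_zero hY h
  refine ⟨ν, ⟨fun m m' => ?_⟩⟩
  have hzero : ∀ m : alexanderModule (FundamentalGroup K.complement ν.basePoint), m = 0 := fun m => by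
    obtain ⟨c, rfl⟩ := alexanderModule.mk_surjective m
    exact alexanderModule.mk_eq_zero_iff.2 (mem_commutator_commutator_iff.2 (hν c.2))
  rw [hzero m, hzero m']

end Obstruction

/-! ### `π₁(S² × S¹)` is abelian -/

section SphereProduct

/-- **`π₁(𝕊¹)` is abelian** (it is `ℤ`: Hatcher, Thm. 1.7, in the tree
`fundamentalGroupCircleEquiv` for Mathlib's circle group `Circle ⊆ ℂ`, transported along the
homeomorphism `Circle ≃ₜ 𝕊¹` given by the isometry `ℂ ≃ ℝ²` — the construction of
`circleHomeomorphSphereOne` in `ThreeTorusHomologyOne.lean`, not imported here).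
[cite: HatcherAT2002, Thm. 1.7 (p. 29)] -/
theorem fundamentalGroup_sphereOne_comm (v : Metric.sphere (0 : EuclideanSpace ℝ (Fin 2)) 1)
    (a b : FundamentalGroup (Metric.sphere (0 : EuclideanSpace ℝ (Fin 2)) 1) v) :
    a * b = b * a := by
  have h : (Complex.orthonormalBasisOneI.repr.toHomeomorph : ℂ ≃ₜ EuclideanSpace ℝ (Fin 2)) ''
      Metric.sphere (0 : ℂ) 1 = (Metric.sphere (0 : EuclideanSpace ℝ (Fin 2)) 1) := by
    have h := Complex.orthonormalBasisOneI.repr.toIsometryEquiv.image_sphere 0 1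
    rw [LinearIsometryEquiv.coe_toIsometryEquiv, map_zero] at h
    exact h
  let hC : Circle ≃ₜ (Metric.sphere (0 : EuclideanSpace ℝ (Fin 2)) 1) :=
    ((Complex.orthonormalBasisOneI.repr.toHomeomorph.image (Metric.sphere (0 : ℂ) 1)).trans
      (Homeomorph.setCongr h) : ↥(Metric.sphere (0 : ℂ) 1) ≃ₜ (Metric.sphere (0 : EuclideanSpace ℝ (Fin 2)) 1))
  let e := (Literature.AlgebraicTopology.FundamentalGroup.fundamentalGroupEquivOfHomeomorph
    hC.symm (rfl : hC.symm v = _)).trans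
    (Literature.AlgebraicTopology.FundamentalGroup.fundamentalGroupCircleEquiv (hC.symm v))
  exact e.injective (by rw [map_mul, map_mul, mul_comm])

/-- **`π₁(S² × S¹)` is abelian**: `π₁(S² × S¹) ≅ π₁(S²) × π₁(S¹) = 1 × ℤ` (Hatcher, Prop. 1.12,
Prop. 1.14, Thm. 1.7). [cite: HatcherAT2002, Prop. 1.12 (p. 34)] -/
theorem fundamentalGroup_sphereTwo_prod_sphereOne_comm
    (y : (Metric.sphere (0 : EuclideanSpace ℝ (Fin 3)) 1) × (Metric.sphere (0 : EuclideanSpace ℝ (Fin 2)) 1))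
    (a b : FundamentalGroup
      ((Metric.sphere (0 : EuclideanSpace ℝ (Fin 3)) 1) ×
        (Metric.sphere (0 : EuclideanSpace ℝ (Fin 2)) 1)) y) :
    a * b = b * a := by
  haveI : Fact (Module.finrank ℝ (EuclideanSpace ℝ (Fin 3)) = 2 + 1) := ⟨by simp⟩
  haveI : SimplyConnectedSpace (Metric.sphere (0 : EuclideanSpace ℝ (Fin 3)) 1) :=
    Literature.AlgebraicTopology.FundamentalGroup.simplyConnectedSpace_sphere le_rfl
  obtain ⟨s, v⟩ := y
  exact Literature.AlgebraicTopology.FundamentalGroup.fundamentalGroup_prod_comm s v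
    (fun u w => Subsingleton.elim _ _) (fundamentalGroup_sphereOne_comm v) a b

end SphereProduct

/-! ### Property R for knots with non-trivial Alexander polynomial -/

section PropertyR

/-- **If `S² × S¹` is `0`-surgery on `K`, the knot group has `G' = G''`** at the base point of some
tubular neighbourhood (`π₁(S² × S¹) = ℤ` is abelian). [folklore] -/
theorem Knot.commutator_le_commutator_commutator_of_isIntegralSurgery_sphereTwo_prod_zero {K : Knot}
    (h : IsIntegralSurgery ((𝓡 2).prod (𝓡 1))
      ((Metric.sphere (0 : EuclideanSpace ℝ (Fin 3)) 1) ×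
        (Metric.sphere (0 : EuclideanSpace ℝ (Fin 2)) 1)) K 0) :
    ∃ ν : Knot.TubularNbhd K,
      commutator (FundamentalGroup K.complement ν.basePoint) ≤
        ⁅commutator (FundamentalGroup K.complement ν.basePoint),
          commutator (FundamentalGroup K.complement ν.basePoint)⁆ :=
  Knot.commutator_le_commutator_commutator_of_isIntegralSurgery_zero
    fundamentalGroup_sphereTwo_prod_sphereOne_comm h

/-- **If `S² × S¹` is `0`-surgery on `K`, the Alexander module of the knot group vanishes at every
base point** (base-point change along `Knot.groupMulEquiv`, functoriality of the Alexander module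
under group isomorphisms `exists_alexanderModule_addEquiv`). Rolfsen (1976), §7.A–C. [folklore] -/
theorem Knot.alexanderModule_subsingleton_of_isIntegralSurgery_sphereTwo_prod_zero {K : Knot}
    (h : IsIntegralSurgery ((𝓡 2).prod (𝓡 1))
      ((Metric.sphere (0 : EuclideanSpace ℝ (Fin 3)) 1) ×
        (Metric.sphere (0 : EuclideanSpace ℝ (Fin 2)) 1)) K 0)
    (x : K.complement) : Subsingleton (alexanderModule (K.group x)) := by
  obtain ⟨ν, hν⟩ := Knot.alexanderModule_subsingleton_of_isIntegralSurgery_zero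
    fundamentalGroup_sphereTwo_prod_sphereOne_comm h
  haveI : Knot.ComplementFacts := Knot.complementFacts_holds
  haveI : Subsingleton (alexanderModule (K.group ν.basePoint)) := hν
  obtain ⟨f, -⟩ := exists_alexanderModule_addEquiv (K.groupMulEquiv x ν.basePoint)
  exact f.toEquiv.subsingleton

/-- **If `S² × S¹` is `0`-surgery on `K` then `Δ_K ≐ 1`** (`K.HasTrivialAlexanderPolynomial`): the
Alexander module of the knot group vanishes
(`Knot.alexanderModule_subsingleton_of_isIntegralSurgery_zero` with `π₁(S² × S¹)` abelian), so the
Alexander ideal is the unit ideal and `1` is an Alexander polynomial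
(`isAlexanderPolynomial_one_of_subsingleton`, with `Gᵃᵇ ≅ ℤ` from
`Knot.TubularNbhd.exists_abelianization_mulEquiv_apply_meridian`). The classical elementary half of
Property R (Kirby, Problem 1.16; Gabai 1987, Remark 8.5, settles the rest). [folklore] -/
theorem Knot.hasTrivialAlexanderPolynomial_of_isIntegralSurgery_sphereTwo_prod_zero {K : Knot}
    (h : IsIntegralSurgery ((𝓡 2).prod (𝓡 1))
      ((Metric.sphere (0 : EuclideanSpace ℝ (Fin 3)) 1) ×
        (Metric.sphere (0 : EuclideanSpace ℝ (Fin 2)) 1)) K 0) :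
    K.HasTrivialAlexanderPolynomial := by
  obtain ⟨ν, hν⟩ := Knot.alexanderModule_subsingleton_of_isIntegralSurgery_zero
    fundamentalGroup_sphereTwo_prod_sphereOne_comm h
  obtain ⟨e, -⟩ := ν.exists_abelianization_mulEquiv_apply_meridian
  haveI : Subsingleton (alexanderModule (K.group ν.basePoint)) := hν
  exact ⟨ν.basePoint, isAlexanderPolynomial_one_of_subsingleton (K.group ν.basePoint) e⟩

/-- **If `S² × S¹` is `0`-surgery on `K`, every Alexander polynomial of `K` is a unit of
`ℤ[t, t⁻¹]`** (`±tᵏ`): the Alexander ideal of the knot group at every base point is the unit ideal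
(base-point independence by `Knot.isAlexanderPolynomial_iff_forall`,
`IsAlexanderPolynomial.of_mulEquiv_holds`, `Knot.complementFacts_holds`). [folklore] -/
theorem Knot.isUnit_of_isAlexanderPolynomial_of_isIntegralSurgery_sphereTwo_prod_zero {K : Knot}
    (h : IsIntegralSurgery ((𝓡 2).prod (𝓡 1))
      ((Metric.sphere (0 : EuclideanSpace ℝ (Fin 3)) 1) ×
        (Metric.sphere (0 : EuclideanSpace ℝ (Fin 2)) 1)) K 0) {Δ : ℤ[T;T⁻¹]}
    (hΔ : K.IsAlexanderPolynomial Δ) : IsUnit Δ := by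
  obtain ⟨ν, hν⟩ := Knot.alexanderModule_subsingleton_of_isIntegralSurgery_zero
    fundamentalGroup_sphereTwo_prod_sphereOne_comm h
  haveI : Knot.ComplementFacts := Knot.complementFacts_holds
  haveI : Subsingleton (alexanderModule (K.group ν.basePoint)) := hν
  have hx := (Knot.isAlexanderPolynomial_iff_forall IsAlexanderPolynomial.of_mulEquiv_holds K Δ).1 hΔ
    ν.basePoint
  obtain ⟨e, he⟩ := hx
  change (alexanderIdeal (FundamentalGroup K.complement ν.basePoint)).map _ = _ at he
  rw [alexanderIdeal_eq_top_of_subsingleton, Ideal.map_top] at he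
  exact Ideal.span_singleton_eq_top.1 he.symm

/-- **Property R for knots with non-trivial Alexander polynomial** (the elementary half of
Property R; Kirby's problem list, Problem 1.16, and Gabai 1987, Remark 8.5, for the history): if
`K` has an Alexander polynomial that is not a unit of `ℤ[t, t⁻¹]` (i.e. `Δ_K ≠ 1`), then
`0`-surgery on `K` does not yield `S² × S¹`. The case `Δ_K = 1` is Gabai's theorem
(`isUnknot_of_isIntegralSurgery_zero`, not proved here). [folklore] -/
theorem Knot.not_isIntegralSurgery_sphereTwo_prod_zero_of_not_isUnit {K : Knot} {Δ : ℤ[T;T⁻¹]}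
    (hΔ : K.IsAlexanderPolynomial Δ) (hu : ¬ IsUnit Δ) :
    ¬ IsIntegralSurgery ((𝓡 2).prod (𝓡 1))
      ((Metric.sphere (0 : EuclideanSpace ℝ (Fin 3)) 1) ×
        (Metric.sphere (0 : EuclideanSpace ℝ (Fin 2)) 1)) K 0 := fun h =>
  hu (Knot.isUnit_of_isAlexanderPolynomial_of_isIntegralSurgery_sphereTwo_prod_zero h hΔ)

end PropertyR

end Literature.Topology.FourManifolds
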